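import Summits.QuantumFields.BalabanUV.Beta.LagrangeFoldMixed

/-!
# `BalabanUV.Beta.StraightMixedSandwich` — binder row D1, located question X-an2-57 (t2′) ∕ compute line R-D1-X57-LAMCOEFF: **THE KKT MIXED
# SANDWICH AT THE STRAIGHT STEP RESOLVENTS** `(KInvStep (j+1) ∘ E2 (j+1) ∘ KInvStep (j+1))_mm = −(wVH (j+1))⁻¹ · (KInvStep (j+1))_mm`, and its
# reading as THE RESPONSE-SIDE UNIT OF THE Λ-SECTOR: `Σ'_v Σ_κ′ lamCoeffK (KInvStep (j+1)) (E2 (j+1)) Lc m x′ κ′ v · KInvStep (j+1) v (Lc•z′) (inl κ′) (inr m′)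
# = −(wVH (j+1))⁻¹ · KInvStep (j+1) (Lc•x′) (Lc•z′) (inr m) (inr m′)` (β sub-cell, BINDER-OWNERS row D1 OWNER `b2b-balaban-beta-an2`, gen 34)

HONEST FRAMING (cell charter, verbatim): «discharging BetaPertH makes Balaban's UV stability UNCONDITIONAL — a real constructive-QFT result; it is
NOT the continuum limit and NOT the Clay problem.»  HONEST DEPENDENCY: continuum YM on T⁴ ⇐ BetaPertH ∧ nine spine estimates (0/9 proved);
BetaPertH ⇐ (D1) ∧ (D4) ∧ CAP+tail; G-an2-4 gates asym, D1 and NE2/3/4.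
NOT IN PRINT; OUR BOOKKEEPING.  [folklore] kernel algebra over tree objects BY NAME (gen 29's `LagrangeFoldMixed.mm_mixed_sandwich_eq_neg` with (R1)
`LagrangeFoldMixed.comp_KInvStep_bhKStep_inr_inl` and (R2) `BorderedHessian.comp_bhKStep_KInvStep_inr_inr` (`StepResidualBorder`) — the STRAIGHT resolvent on BOTH
sides, where gen 29 instantiated the right factor at the symmetrised `Gsym`); no statement of Bałaban's papers, no `[cite:]`, no `def`, no `def … : Prop`;
instantiates NO binder of the β-function wall.  NOT D1, NOT `BetaPertH`, NOT continuum, NOT Clay.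

WHY (records: requests.jsonl l.2036 R-D1-X57-LAMCOEFF-SCALAR; memo `HOME/b2b-balaban-beta-an2/gen34/X57-SCALAR.v1.md`).  The Λ-sector of the step stencil
`SrecOf (j+1)` enters the one-step kernel only through `lamCoeffK ∘ colH`, i.e. only through the multiplier block of the mixed sandwich
`KInvStep ∘ E2 ∘ G`.  For the literal's resolvent `G = Gsym` that block is `LagrangeFoldMixed.colM_mixed_sandwich_E2_sym`; THIS file records the same identity for the
STRAIGHT (typed, comb) resolvent `G = KInvStep (j+1)` — the object the balaban-calc engines solve exactly on a torus (Engine C's level-1 block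
`lamCoeffK (KInvStep 3 1) (E2 1) 3`, LAMCOEFF.md) — so that the lane's exact finite-volume contraction (S1) has a BY-NAME kernel statement on `ℤ^{d+1}`:
the unit is `(wVH (j+1))⁻¹ = (Lc^{j+1})^{−2(d+2)}`.

* §1 `comp_bhKStep_KInvStep_inr_inr'` — (R2) for the straight resolvent in the shape `mm_mixed_sandwich_eq_neg` consumes (`[u = z ∧ ν = m′]` on coarse rows).
* §2 **`mm_mixed_sandwich_E2_straight`** — the identity at coarse points; **`tsum_lamCoeffK_mul_KInvStep_inl_inr`** — the same with the left factor spelled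
  as the Λ-conversion coefficients `lamCoeffK` (the multiplier legs of `E2` vanish, `LagrangeFold.E2_inr_col`).
Provenance: β sub-cell, unit beta-an2 gen 34, 2026-08-21 (v1); over `LagrangeFoldMixed` ∕ `StepResidualBorder` ∕ `LagrangeFold` BY NAME; no existing file touched.
-/

noncomputable section

open Finset
open scoped BigOperators
open Literature.MathematicalPhysics.QuantumFieldTheory
open Literature.MathematicalPhysics.QuantumFieldTheory.Balaban1983to89
open Literature.MathematicalPhysics.QuantumFieldTheory.Balaban1983to89.Beta
open ExpKernelCalculus (MKer Decays comp)
open KernelWard (bdd_of_decays)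
open OneStepResolventKernel (Fib eq_zsmul_quo_of_proj)
open OneStepKernelFamily (KInvStep decays_KInvStep)
open BalabanStepJetsSucc (E2 wVH lamCoeffK)
open Literature.Probability.LatticeModels (Torus.proj)
open Summit.QuantumFields.BalabanUV.Beta.TameKernelCalculus
open Summit.QuantumFields.BalabanUV.Beta.BorderedHessian (bhKStep bhKStep_succ_inl_inl spr_bhKStep comp_bhKStep_KInvStep_inr_inr)
open Summit.QuantumFields.BalabanUV.Beta.LagrangeFold (E2_inr_col comp_inr_col_eq_zero)
open Summit.QuantumFields.BalabanUV.Beta.LagrangeFoldStep (wVH_ne_zero)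
open Summit.QuantumFields.BalabanUV.Beta.LagrangeFoldMixed (mm_mixed_sandwich_eq_neg comp_KInvStep_bhKStep_inr_inl KInvStep_inr_inr_of_col_off)

namespace Summit.QuantumFields.BalabanUV.Beta.StraightMixedSandwich

variable {d Lc : ℕ} [NeZero Lc]

/-! ## §1 (R2) for the straight resolvent, in the shape of `mm_mixed_sandwich_eq_neg` -/

/-- [folklore] **(R2) AT THE STRAIGHT RESOLVENT**: on coarse rows `u`, `(bhKStep (j+1) ∘ KInvStep (j+1))(u,z)(inr ν, inr m′) = [u = z][ν = m′]`
(`StepResidualBorder.comp_bhKStep_KInvStep_inr_inr`, whose `[quo u = quo z]` on two coarse points is `[u = z]`). -/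
theorem comp_bhKStep_KInvStep_inr_inr' (j : ℕ) (u z : Fin (d + 1) → ℤ) (ν m' : Fin (d + 1)) (hu : Torus.proj Lc u = 0) :
    comp (bhKStep d Lc (j + 1)) (KInvStep (d := d) Lc (j + 1)) u z (Sum.inr ν) (Sum.inr m') = if u = z ∧ ν = m' then 1 else 0 := by
  rw [comp_bhKStep_KInvStep_inr_inr]
  by_cases hz : Torus.proj Lc z = 0
  · rw [if_pos ⟨hu, hz⟩]
    by_cases h : u = z ∧ ν = m'
    · rw [if_pos h, if_pos ⟨by rw [h.1], h.2⟩]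
    · rw [if_neg h, if_neg]
      rintro ⟨hq, hν⟩
      exact h ⟨(eq_zsmul_quo_of_proj (N := Lc) hu).trans (hq ▸ (eq_zsmul_quo_of_proj (N := Lc) hz).symm), hν⟩
  · have hne : ¬ (u = z ∧ ν = m') := fun h => hz (h.1 ▸ hu)
    rw [if_neg (fun h => hz h.2), if_neg hne]

/-! ## §2 The straight mixed sandwich and its `lamCoeffK` reading -/

/-- [folklore] **THE KKT MIXED SANDWICH AT THE STRAIGHT STEP RESOLVENTS, LEVEL `j+1`** (coarse points):
`(KInvStep (j+1) ∘ E2 (j+1) ∘ KInvStep (j+1))(Lc•x′, Lc•z′)(inr m, inr m′) = −(wVH (j+1))⁻¹ · KInvStep (j+1) (Lc•x′, Lc•z′)(inr m, inr m′)` —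
`mm_mixed_sandwich_eq_neg` at `(A, 𝕄, G, H) := (KInvStep (j+1), bhKStep (j+1), KInvStep (j+1), wVH (j+1) • E2 (j+1))`. -/
theorem mm_mixed_sandwich_E2_straight (j : ℕ) (x' z' : Fin (d + 1) → ℤ) (m m' : Fin (d + 1)) :
    comp (comp (KInvStep (d := d) Lc (j + 1)) (E2 d Lc (j + 1))) (KInvStep (d := d) Lc (j + 1))
        ((Lc : ℤ) • x') ((Lc : ℤ) • z') (Sum.inr m) (Sum.inr m')
      = -(wVH d Lc (j + 1))⁻¹ * KInvStep (d := d) Lc (j + 1) ((Lc : ℤ) • x') ((Lc : ℤ) • z') (Sum.inr m) (Sum.inr m') := by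
  set A := KInvStep (d := d) Lc (j + 1) with hAdef
  set H : MKer (d + 1) (Fib d) := fun x z a b => wVH d Lc (j + 1) * E2 d Lc (j + 1) x z a b with hH
  have hw : wVH d Lc (j + 1) ≠ 0 := wVH_ne_zero (j + 1)
  obtain ⟨CM, δM, hδM, hMd⟩ := spr_bhKStep (d := d) (Lc := Lc) (j + 1)
  have hkkt := mm_mixed_sandwich_eq_neg (N := Lc) (A := A) (M := bhKStep d Lc (j + 1)) (G := A) (H := H)
    (decays_KInvStep (Lc := Lc) (d := d) (j + 1)) (decays_KInvStep (Lc := Lc) (d := d) (j + 1))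
    ⟨CM, fun x z a b => bdd_of_decays hMd hδM.le x z a b⟩ (fun x z ν ν' => rfl)
    (fun x z κ l => by rw [hH, bhKStep_succ_inl_inl]) (fun x z κ ν => by simp only [hH, E2_inr_col, mul_zero])
    (fun x z ν l => by simp only [hH]; exact mul_eq_zero_of_right _ rfl) (fun x z ν ν' => by simp only [hH, E2_inr_col, mul_zero])
    (fun x v m l => comp_KInvStep_bhKStep_inr_inl (d := d) (Lc := Lc) j x v m l)
    (fun u z ν m' hu => comp_bhKStep_KInvStep_inr_inr' (d := d) (Lc := Lc) j u z ν m' hu)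
    (fun x u m ν hu => KInvStep_inr_inr_of_col_off (d := d) (Lc := Lc) (j + 1) x u m ν hu)
    ((Lc : ℤ) • x') ((Lc : ℤ) • z') m m'
  -- comp (comp A H) A = wVH • comp (comp A E2) A, entrywise
  have hlin : comp (comp A H) A ((Lc : ℤ) • x') ((Lc : ℤ) • z') (Sum.inr m) (Sum.inr m')
      = wVH d Lc (j + 1) * comp (comp A (E2 d Lc (j + 1))) A ((Lc : ℤ) • x') ((Lc : ℤ) • z') (Sum.inr m) (Sum.inr m') := by
    have hAH : comp A H = fun x z a b => wVH d Lc (j + 1) * comp A (E2 d Lc (j + 1)) x z a b := by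
      funext x z a b
      simp only [ExpKernelCalculus.comp, hH, ← tsum_mul_left, Finset.mul_sum]
      exact tsum_congr fun u => Finset.sum_congr rfl fun f _ => by ring
    rw [hAH]
    rw [show comp (fun x z a b => wVH d Lc (j + 1) * comp A (E2 d Lc (j + 1)) x z a b) A ((Lc : ℤ) • x') ((Lc : ℤ) • z') (Sum.inr m) (Sum.inr m')
        = ∑' v, ∑ g : Fib d, (wVH d Lc (j + 1) * comp A (E2 d Lc (j + 1)) ((Lc : ℤ) • x') v (Sum.inr m) g) * A v ((Lc : ℤ) • z') g (Sum.inr m')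
        from rfl,
      show comp (comp A (E2 d Lc (j + 1))) A ((Lc : ℤ) • x') ((Lc : ℤ) • z') (Sum.inr m) (Sum.inr m')
        = ∑' v, ∑ g : Fib d, comp A (E2 d Lc (j + 1)) ((Lc : ℤ) • x') v (Sum.inr m) g * A v ((Lc : ℤ) • z') g (Sum.inr m') from rfl,
      ← tsum_mul_left]
    exact tsum_congr fun v => by rw [Finset.mul_sum]; exact Finset.sum_congr rfl fun g _ => by ring
  rw [hlin] at hkkt
  field_simp
  linarith

/-- [folklore] **THE RESPONSE-SIDE UNIT OF THE Λ-SECTOR, BY NAME** (the kernel statement behind the balaban-calc contraction (S1) of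
R-D1-X57-LAMCOEFF-SCALAR): with the Λ-conversion coefficients `lamCoeffK A E N μ y κ′ u′ := (A ∘ E)(N•y, u′)(inr μ, inl κ′)` (`BalabanStepJetsSucc` :410),
`Σ'_v Σ_κ′ lamCoeffK (KInvStep (j+1)) (E2 (j+1)) Lc m x′ κ′ v · KInvStep (j+1) (v, Lc•z′)(inl κ′, inr m′) = −(wVH (j+1))⁻¹ · KInvStep (j+1) (Lc•x′, Lc•z′)(inr m, inr m′)`
— the step multiplier response, driven once more through the step minimiser, returns the step multiplier kernel with the unit `(Lc^{j+1})^{−2(d+2)}`. -/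
theorem tsum_lamCoeffK_mul_KInvStep_inl_inr (j : ℕ) (x' z' : Fin (d + 1) → ℤ) (m m' : Fin (d + 1)) :
    ∑' v, ∑ κ' : Fin (d + 1), lamCoeffK (KInvStep (d := d) Lc (j + 1)) (E2 d Lc (j + 1)) Lc m x' κ' v
        * KInvStep (d := d) Lc (j + 1) v ((Lc : ℤ) • z') (Sum.inl κ') (Sum.inr m')
      = -(wVH d Lc (j + 1))⁻¹ * KInvStep (d := d) Lc (j + 1) ((Lc : ℤ) • x') ((Lc : ℤ) • z') (Sum.inr m) (Sum.inr m') := by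
  rw [← mm_mixed_sandwich_E2_straight j x' z' m m']
  rw [show comp (comp (KInvStep (d := d) Lc (j + 1)) (E2 d Lc (j + 1))) (KInvStep (d := d) Lc (j + 1))
        ((Lc : ℤ) • x') ((Lc : ℤ) • z') (Sum.inr m) (Sum.inr m')
      = ∑' v, ∑ g : Fib d, comp (KInvStep (d := d) Lc (j + 1)) (E2 d Lc (j + 1)) ((Lc : ℤ) • x') v (Sum.inr m) g
          * KInvStep (d := d) Lc (j + 1) v ((Lc : ℤ) • z') g (Sum.inr m') from rfl]
  refine tsum_congr fun v => ?_
  rw [Fintype.sum_sum_type]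
  simp only [comp_inr_col_eq_zero (fun v u h ν => E2_inr_col Lc (j + 1) v u h ν), zero_mul, Finset.sum_const_zero, add_zero]
  rfl

end Summit.QuantumFields.BalabanUV.Beta.StraightMixedSandwich

end
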